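import Literature.NumberTheory.GelbartRogawski1991.LocalUnitarySplittingsCM
import Literature.NumberTheory.Automorphic.UnitaryIsotropicCharactersDet
import HarnessLib

-- buildfix G11b-3 recipe (LEDGER B13-1/B13-3), as in the GelbartRogawski1991 siblings: elaborate sequentially so the
-- trailing `attribute [implicit_reducible]` block is in force at `.olean` export (inert for the kernel).
set_option Elab.async false

/-!
# Local uniqueness of Kudla's splitting: two local splitting data with the same Leray section differ by a CHARACTER of
# `U(J)(F_v)`; for the doubled group at a non-split place that character dies on `U(𝕍) × 1` only if it dies everywhere

Topic `NumberTheory/GelbartRogawski1991`; namespace `Literature.NumberTheory.GelbartRogawski1991.UnitaryDualPair.LocalSplitting`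
(that of `LocalUnitarySplittingDatum`, `LocalDoubledUnitarySplittingData`, `LocalUnitaryUndoubling`).  KERNEL ONLY: theorems; no
definition, no named fact, no `sorry`.  The LOCAL twin of the tree's global torsor statements
(`DoubledWeilRepresentationUniqueness.isDoubledWeilRep_unique`, `DoubledWeilRepresentationDetTwist.eq_detTwist`,
[GelbartRogawski1991, §3.1 Remark p. 457 L4–13]: «if `s*` is any other compatible splitting, then `s* = s ⊗ ν′`»), written for the
`μ`-clause of [Liu2021, App. D Lem. D.1 (3)] (cell `hodgecm-mathlib`, line a4-liuD3, stubs `stub_mu_of_iso_nonsplit` /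
`stub_splitInjective` / `stub_iso_of_params`: «the local splitting `s_μ` DETERMINES `μ_v`»).

* §1 (any `U(J)(F_v)`, two data `D, D'` of `LocalSplittingDatum` with the SAME Leray section `D'.r = D.r` — e.g. the tree's
  non-split data `localSplittingDatumNonsplit … χv …` for two character families, whose `r` is Rao's `L0D` for both):
  `s'_v(g) = i(κ(g)) · s_v(g)` with `κ = β / β'` (`localSplitting_eq_ofScalar_mul`), and **`κ` is a character**
  (`exists_betaRatioChar`: `∂β = ∂β' = c_r`);
* §2 (the doubled group `H = U(J ⊕ −J)(F_v)`): if the UNDOUBLINGS agree, `undoubleLoc s_v = undoubleLoc s'_v`, then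
  `κ = 1` on `U(J)(F_v) × 1` (`betaRatio_inlLoc_eq_one`: compare `ω(s(g ⊕ 1))(f₁ ⊠ f₂) = ω(undoubleLoc s g) f₁ ⊠ f₂`);
* §3 at a NON-SPLIT `v` (`E ⊗ F_v` a field) **every homomorphism `H(F_v) →* A` to a commutative group kills the elements of
  determinant one** (`doubled_apply_eq_one_of_det_eq_one`: the doubled form `J ⊕ −J` is isotropic — the vector `e_i ⊕ e_i` —
  so the general-rank engine `UnitaryIsotropic.apply_eq_one_of_det_eq_one'` [Dieudonne1971GroupesClassiques, Chap. II §5] applies);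
* §4 hence **`β' = β` on ALL of `H(F_v)`** as soon as the undoublings agree and `det` restricted to `U(J) × 1` reaches every
  determinant of `H(F_v)` (`beta_eq_of_undoubleLoc_eq`; the determinant hypothesis is discharged for diagonal `T₀` in the sequel
  `LocalKudlaSplittingInjective`, where the parabolic values `β|_{P_Δ} = χ_v ∘ det_Δ` turn `β' = β` into `χ'_v = χ_v`, i.e.
  `localMu χ' v = localMu χ v`).

## References
* [GelbartRogawski1991] S. Gelbart, J. Rogawski, Invent. Math. 105 (1991), §3.1 Prop. 3.1.1 p. 455, Remark p. 457 L4–13.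
* [Kudla1994] S. Kudla, Israel J. Math. 87 (1994), §3, Thm. 3.1.  [HarrisKudlaSweet1996] M. Harris, S. Kudla, W. Sweet, J. AMS 9
  (1996), §1 (1.11)–(1.16).
* [Dieudonne1971GroupesClassiques] J. Dieudonné, *La géométrie des groupes classiques*, 3e éd. (1971), Chap. II §5.
* [Liu2021] Y. Liu, Camb. J. Math. 9 (2021), App. D Lem. D.1 (3) (l. 5233).
-/

set_option autoImplicit false

noncomputable section

open NumberField IsDedekindDomain MeasureTheory Matrix
open Literature.RepresentationTheory.HeisenbergGroup
open Literature.NumberTheory.Automorphic Literature.NumberTheory.Automorphic.UnitaryGroup Literature.NumberTheory.Weil1964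

namespace Literature.RepresentationTheory.HeisenbergGroup

/-- `ω(i(a) · x) f = a • ω(x) f`: the central subgroup `i(kˣ)` of MVW's `S̃p_ψ` acts by scalars in the tautological
representation. [cite: MoeglinVignerasWaldspurger1987, Chap. 2 II.1 (B)] -/
theorem MpPsi.toRep_ofScalar_mul {R : Type*} [CommRing R] [Invertible (2 : R)] {V : Type*} [AddCommGroup V] [Module R V]
    {B : V →ₗ[R] V →ₗ[R] R} {k : Type*} [Field k] {S : Type*} [AddCommGroup S] [Module k S]
    (ρ : Representation k (Heisenberg B) S) (a : kˣ) (x : MpPsi ρ) (f : S) :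
    MpPsi.toRep ρ (MpPsi.ofScalar ρ a * x) f = (a : k) • MpPsi.toRep ρ x f := by
  simp only [MpPsi.toRep_apply, Subgroup.coe_mul, Prod.snd_mul, LinearEquiv.mul_apply, MpPsi.coe_ofScalar, scalarOp_apply]

/-- group algebra behind `s' = i(κ) · s`: `z(b⁻¹) R = z(b⁻¹ a) (z(a⁻¹) R)` for a homomorphism `z`. [folklore] -/
private theorem MpPsi.map_inv_mul_eq_map_mul_mul {G A : Type*} [Group G] [CommGroup A] (z : A →* G) (a b : A) (R : G) :
    z b⁻¹ * R = z (b⁻¹ * a) * (z a⁻¹ * R) := by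
  rw [← mul_assoc, ← map_mul, mul_assoc b⁻¹, mul_inv_cancel, mul_one]

end Literature.RepresentationTheory.HeisenbergGroup

namespace Literature.NumberTheory.GelbartRogawski1991.UnitaryDualPair.LocalSplitting

variable (F : Type) [Field F] [NumberField F] (E : Type) [Field E] [NumberField E] [Algebra F E]
  [Algebra.IsQuadraticExtension F E] (c : E ≃ₐ[F] E)
  {δ : E} (hcδ : c δ = -δ) (hδ : δ ≠ 0) {d : F} (hd : δ * δ = algebraMap F E d)
  (v : HeightOneSpectrum (𝓞 F))
  [MeasurableSpace (v.adicCompletion F)] [BorelSpace (v.adicCompletion F)]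
  (μ : Measure (v.adicCompletion F)) [μ.IsAddHaarMeasure]

/-! ## §1 Two local splitting data with the same Leray section differ by a character -/

namespace LocalSplittingDatum

variable {F E c hcδ hδ hd v μ} {N : ℕ} {T : Matrix (Fin N) (Fin N) F} {hT : T.IsSymm} {hTd : IsUnit T.det}
  {J : Matrix (Fin N) (Fin N) E} {hJ : J = T.map (algebraMap F E)}
  {ψ' : AddChar (v.adicCompletion F) Circle} {hψ' : ψ'.IsContinuousNontrivial}
  {ℓ : Submodule (v.adicCompletion F) ((Fin N → v.adicCompletion F) × (Fin N → v.adicCompletion F))}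
  {hℓ : LinearMap.BilinForm.orthogonal (alt (polar (localPairing F N T v))) ℓ = ℓ}
  (D D' : LocalSplittingDatum F E c N hcδ hδ hd T hT hTd hJ v μ ℓ hℓ)

/-- unfolding: `s_v(g) = i(β(g))⁻¹ · (ι g, r(ι g))`. [cite: GelbartRogawski1991, §3.1 Prop. 3.1.1 p. 455 L1–3] -/
theorem localSplitting_apply (g : UnitaryGroup.localPi E c N J v) :
    D.localSplitting g = MpPsi.ofScalar _ (D.beta g)⁻¹ * D.r.secMpPsi (iota F E c N hcδ hδ hd T hT hJ v g) := rfl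

/-- **two data with the same Leray section differ by the scalars `κ = β / β'`**: `s'_v(g) = i((β' g)⁻¹ β g) · s_v(g)`.
[cite: GelbartRogawski1991, §3.1 Remark p. 457 L9–13] -/
theorem localSplitting_eq_ofScalar_mul (hr : D'.r = D.r) (g : UnitaryGroup.localPi E c N J v) :
    D'.localSplitting g = MpPsi.ofScalar _ ((D'.beta g)⁻¹ * D.beta g) * D.localSplitting g := by
  obtain ⟨r', hU', hcyc', β', hβ₁', hβ', hsm'⟩ := D'
  change r' = D.r at hr
  subst hr
  exact MpPsi.map_inv_mul_eq_map_mul_mul (MpPsi.ofScalar (localSchrodinger F N T v)) (D.beta g) (β' g) _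

/-- the multipliers agree: `c_{r'} = c_r` (same section; the uniqueness witnesses are propositions).
[cite: Kudla1994, Thm 3.1] -/
theorem cocycle_eq_of_r_eq (hr : D'.r = D.r) (x y : LocalSp F N T v) :
    D'.r.cocycle D'.hU x y = D.r.cocycle D.hU x y := by
  rw [hr]

/-- **`κ = β / β'` is multiplicative** (`∂β = c_r = ∂β'`). [cite: Kudla1994, Thm 3.1] -/
theorem betaRatio_mul (hr : D'.r = D.r) (g₁ g₂ : UnitaryGroup.localPi E c N J v) :
    (D'.beta (g₁ * g₂))⁻¹ * D.beta (g₁ * g₂) = (D'.beta g₁)⁻¹ * D.beta g₁ * ((D'.beta g₂)⁻¹ * D.beta g₂) := by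
  have h := congrArg Units.val (D.beta_mul g₁ g₂)
  have h' := congrArg Units.val (D'.beta_mul g₁ g₂)
  rw [cocycle_eq_of_r_eq D D' hr] at h'
  apply Units.val_injective
  simp only [Units.val_mul, Units.val_inv_eq_inv_val] at h h' ⊢
  have h1 := (D.beta (g₁ * g₂)).ne_zero
  have h2 := (D'.beta (g₁ * g₂)).ne_zero
  have h3 := (D.beta g₁).ne_zero
  have h4 := (D'.beta g₁).ne_zero
  have h5 := (D.beta g₂).ne_zero
  have h6 := (D'.beta g₂).ne_zero
  have h7 := (D.r.cocycle D.hU (iota F E c N hcδ hδ hd T hT hJ v g₁) (iota F E c N hcδ hδ hd T hT hJ v g₂)).ne_zero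
  field_simp
  linear_combination (D'.beta (g₁ * g₂) : ℂ) * h - (D.beta (g₁ * g₂) : ℂ) * h'

/-- **the ratio `κ = β / β'` is a CHARACTER of `U(J)(F_v)`** and `s'_v = i(κ) · s_v` — the local form of «`s* = s ⊗ ν′`».
[cite: GelbartRogawski1991, §3.1 Remark p. 457 L9–13] -/
theorem exists_betaRatioChar (hr : D'.r = D.r) :
    ∃ κ : UnitaryGroup.localPi E c N J v →* ℂˣ,
      (∀ g, κ g = (D'.beta g)⁻¹ * D.beta g) ∧ ∀ g, D'.localSplitting g = MpPsi.ofScalar _ (κ g) * D.localSplitting g :=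
  ⟨{ toFun := fun g => (D'.beta g)⁻¹ * D.beta g
     map_one' := by rw [D.beta_one, D'.beta_one, inv_one, one_mul]
     map_mul' := betaRatio_mul D D' hr },
    fun _ => rfl, fun g => localSplitting_eq_ofScalar_mul D D' hr g⟩

end LocalSplittingDatum

/-! ## §2 The doubled group: if the undoublings agree, `κ = 1` on `U(J) × 1` -/

section Doubled

variable (n : ℕ) {T₀ : Matrix (Fin n) (Fin n) F} {J : Matrix (Fin n) (Fin n) E} {JD : Matrix (Fin (n + n)) (Fin (n + n)) E}
/- (every hypothesis explicit per declaration — no section `variable` carrying a Prop, per the gate's D-0026 readout) -/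

omit [MeasurableSpace (v.adicCompletion F)] [BorelSpace (v.adicCompletion F)] in
/-- the operator of an element of `S̃p_ψ(𝕎_v)` is injective: `ω(x) Φ ≠ 0` for `Φ ≠ 0`.
[cite: MoeglinVignerasWaldspurger1987, Chap. 2 II.1 (B)] -/
theorem toRep_ne_zero {N : ℕ} {T : Matrix (Fin N) (Fin N) F} (x : LocalMp F N T v)
    {Φ : SchwartzBruhat (Fin N → v.adicCompletion F)} (hΦ : Φ ≠ 0) : MpPsi.toRep (localSchrodinger F N T v) x Φ ≠ 0 := by
  rw [MpPsi.toRep_apply]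
  exact fun h => hΦ ((LinearEquiv.map_eq_zero_iff _).1 h)

-- budget line (ops-buildfix B30 policy): this proof elaborates within the default 200k heartbeats but not within 180k;
-- the explicit margin keeps it clear of the cliff under Mathlib drift. Declarations byte-identical.
set_option maxHeartbeats 400000 in
/-- **if the undoublings of `s_v`, `s'_v` agree then `κ = β / β' = 1` on `U(J)(F_v) × 1`**: both sides of
`ω(s(g ⊕ 1))(f₁ ⊠ f₂) = ω(undoubleLoc s g) f₁ ⊠ f₂` agree for `s` and `s'`, while `ω(s'(h)) = κ(h) • ω(s(h))`.
[cite: GelbartRogawski1991, §3.1 Remark p. 457 L9–13] -/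
theorem betaRatio_inlLoc_eq_one (hT₀ : T₀.IsSymm) (hT₀d : IsUnit T₀.det) (hJ : J = T₀.map (algebraMap F E))
    (hJD : JD = (gramD F n T₀).map (algebraMap F E))
    (D D' : LocalSplittingDatum F E c (n + n) hcδ hδ hd (gramD F n T₀) (gramD_isSymm F n hT₀)
      (isUnit_det_gramD F n hT₀d) hJD v μ (deltaLagrangian F v n) (deltaLagrangian_orthogonal F v n T₀ hT₀d))
    (κ : UnitaryGroup.localPi E c (n + n) JD v →* ℂˣ)
    (hκ : ∀ g, D'.localSplitting g = MpPsi.ofScalar _ (κ g) * D.localSplitting g)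
    (heq : undoubleLoc F E c v n hJ hJD hcδ hδ hd hT₀ hT₀d D.localSplitting D.proj_localSplitting =
      undoubleLoc F E c v n hJ hJD hcδ hδ hd hT₀ hT₀d D'.localSplitting D'.proj_localSplitting)
    (u : UnitaryGroup.localPi E c n J v) : κ (inlLoc F E c v n hJ hJD u) = 1 := by
  obtain ⟨f₁, hf₁⟩ := exists_schwartzBruhat_pi_ne_zero (v.adicCompletion F) (Fin n)
  obtain ⟨f₂, hf₂⟩ := exists_schwartzBruhat_pi_ne_zero (v.adicCompletion F) (Fin n)
  have A := toRep_undoubleLoc_boxSB F E c v n hJ hJD hcδ hδ hd hT₀ hT₀d D.localSplitting D.proj_localSplitting u f₁ f₂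
  have A' := toRep_undoubleLoc_boxSB F E c v n hJ hJD hcδ hδ hd hT₀ hT₀d D'.localSplitting D'.proj_localSplitting u f₁ f₂
  rw [← heq, ← A, hκ, MpPsi.toRep_ofScalar_mul] at A'
  have hX := toRep_ne_zero F v (D.localSplitting (inlLoc F E c v n hJ hJD u))
    (boxSB_ne_zero (v.adicCompletion F) (e₂ n) hf₁ hf₂)
  have h1 : ((κ (inlLoc F E c v n hJ hJD u) : ℂˣ) : ℂ) = 1 := by
    have := smul_left_injective ℂ hX (A'.trans (one_smul ℂ _).symm)
    exact this
  exact Units.val_eq_one.1 h1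

/-! ## §3 At a non-split place every homomorphism `H(F_v) →* A` kills the elements of determinant one -/

omit [MeasurableSpace (v.adicCompletion F)] [BorelSpace (v.adicCompletion F)] in
include hcδ hδ hd in
/-- **`SU(J ⊕ −J)(F_v) ≤ ker θ` at a non-split place** (matrix form `UnitaryGroup.«local»`): `E ⊗_F F_v` is a field and
the doubled hermitian form `J ⊕ −J` is ISOTROPIC (the vector `e_i ⊕ e_i`), so the general-rank engine
`UnitaryIsotropic.apply_eq_one_of_det_eq_one'` applies; no continuity is assumed.
[cite: Dieudonne1971GroupesClassiques, Chap. II §5] -/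
theorem doubled_apply_eq_one_of_det_eq_one (hT₀ : T₀.IsSymm) (hT₀d : IsUnit T₀.det)
    (hJD : JD = (gramD F n T₀).map (algebraMap F E)) (hn : 0 < n) (hE : IsField (LocalRing E v)) {A : Type*} [CommGroup A]
    (θ : ↥(UnitaryGroup.«local» E c (n + n) JD v) →* A) (g : ↥(UnitaryGroup.«local» E c (n + n) JD v))
    (hdet : g.1.1.det = 1) : θ g = 1 := by
  classical
  letI : Field (LocalRing E v) := hE.toField
  set σ := conjLocal E c v with hσdef
  set ι : F →+* LocalRing E v := (algebraMap E (LocalRing E v)).comp (algebraMap F E) with hι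
  have hσσ : ∀ x, σ (σ x) = x := conjLocal_conjLocal' F E c hcδ hδ hd v
  have hθ₀ : σ (algebraMap E (LocalRing E v) δ) = -algebraMap E (LocalRing E v) δ := by
    rw [hσdef, conjLocal_algebraMap, hcδ, map_neg]
  have hθ₀0 : algebraMap E (LocalRing E v) δ ≠ 0 := (map_ne_zero _).2 hδ
  have h2 : (2 : LocalRing E v) ≠ 0 := by
    rw [← map_ofNat (algebraMap E (LocalRing E v)) 2]; exact (map_ne_zero _).2 two_ne_zero
  have hσι : ∀ x : F, σ (ι x) = ι x := fun x => by
    rw [hι, RingHom.comp_apply, hσdef, conjLocal_algebraMap, AlgEquiv.commutes]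
  -- the local form of `J^𝔻 = (T₀ ⊕ −T₀) ⊗ 1` is `(T₀ ⊕ −T₀)` pushed to `E ⊗ F_v`
  have hH : (UnitaryGroup.adelicForm E (n + n) JD).map (adeleToLocal E v) = (gramD F n T₀).map ι := by
    rw [UnitaryGroup.adelicForm, hJD, Matrix.map_map, Matrix.map_map]
    rfl
  have hmapσ : ((gramD F n T₀).map ι).map σ = (gramD F n T₀).map ι := by
    ext i j
    simp only [Matrix.map_apply, hσι]
  have hJh : (((gramD F n T₀).map ι).map σ)ᵀ = (gramD F n T₀).map ι := by
    rw [hmapσ, ← Matrix.transpose_map, (gramD_isSymm F n hT₀).eq]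
  have hJdet : ((gramD F n T₀).map ι).det ≠ 0 := by
    rw [← RingHom.mapMatrix_apply, ← RingHom.map_det]
    exact (map_ne_zero ι).2 (isUnit_det_gramD F n hT₀d).ne_zero
  -- the isotropic vector `e_{i₀} ⊕ e_{i₀}`
  set i₀ : Fin n := ⟨0, hn⟩ with hi₀
  set sv : Fin n → LocalRing E v := Pi.single i₀ 1 with hsv
  set x : Fin (n + n) → LocalRing E v := Sum.elim sv sv ∘ (e₂ n).symm with hx
  have hxe : x ∘ (e₂ n) = Sum.elim sv sv := by
    funext j; simp only [hx, Function.comp_apply, Equiv.symm_apply_apply]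
  have hx0 : x ≠ 0 := by
    intro h0
    have := congrFun h0 ((e₂ n) (Sum.inl i₀))
    rw [hx, Function.comp_apply, Equiv.symm_apply_apply, Sum.elim_inl, hsv, Pi.single_eq_same, Pi.zero_apply] at this
    exact one_ne_zero this
  have hσx : (fun i => σ (x i)) = x := by
    funext i
    rw [hx, Function.comp_apply]
    rcases (e₂ n).symm i with j | j <;>
      · simp only [Sum.elim_inl, Sum.elim_inr, hsv, Pi.single_apply]
        split_ifs <;> simp
  have hneg : (-T₀).map ι = -(T₀.map ι) := by
    ext i j; simp only [Matrix.map_apply, Matrix.neg_apply, map_neg]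
  have hform : (gramD F n T₀).map ι =
      (Matrix.fromBlocks (T₀.map ι) 0 0 (-(T₀.map ι))).submatrix (e₂ n).symm (e₂ n).symm := by
    rw [gramD, Matrix.reindex_apply, ← Matrix.submatrix_map, Matrix.fromBlocks_map, hneg,
      Matrix.map_zero _ (map_zero ι)]
  have hiso : ∃ y : Fin (n + n) → LocalRing E v, y ≠ 0 ∧
      dotProduct (fun i => σ (y i)) (((gramD F n T₀).map ι).mulVec y) = 0 := by
    refine ⟨x, hx0, ?_⟩
    rw [hσx, hform, Matrix.submatrix_mulVec_equiv, Equiv.symm_symm, dotProduct_comp_equiv_symm, hxe,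
      Matrix.fromBlocks_mulVec, Sum.elim_comp_inl, Sum.elim_comp_inr, sumElim_dotProduct_sumElim]
    simp only [Matrix.zero_mulVec, add_zero, zero_add, Matrix.neg_mulVec, dotProduct_neg, add_neg_cancel]
  exact UnitaryIsotropic.apply_eq_one_of_det_eq_one' hσσ hθ₀ hθ₀0 h2 _ ((gramD F n T₀).map ι) hH hJh hJdet hiso θ g hdet

omit [MeasurableSpace (v.adicCompletion F)] [BorelSpace (v.adicCompletion F)] in
include hcδ hδ hd in
/-- the same on the factor form `localPi` (the determinant read through `localPiEquiv`).
[cite: Dieudonne1971GroupesClassiques, Chap. II §5] -/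
theorem doubled_localPi_apply_eq_one_of_det_eq_one (hT₀ : T₀.IsSymm) (hT₀d : IsUnit T₀.det)
    (hJD : JD = (gramD F n T₀).map (algebraMap F E)) (hn : 0 < n) (hE : IsField (LocalRing E v)) {A : Type*}
    [CommGroup A] (θ : UnitaryGroup.localPi E c (n + n) JD v →* A) (u : UnitaryGroup.localPi E c (n + n) JD v)
    (hu : Matrix.GeneralLinearGroup.det
      ((UnitaryGroup.localPiEquiv E c (n + n) JD v u : UnitaryGroup.«local» E c (n + n) JD v) :
        GL (Fin (n + n)) (LocalRing E v)) = 1) : θ u = 1 := by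
  set ψ := UnitaryGroup.localPiEquiv E c (n + n) JD v with hψ
  have hdet : (ψ u).1.1.det = 1 := by
    have := congrArg Units.val hu
    exact this
  have key := doubled_apply_eq_one_of_det_eq_one F E c hcδ hδ hd v n hT₀ hT₀d hJD hn hE (θ.comp ψ.symm.toMonoidHom)
    (ψ u) hdet
  have hup : u = ψ.symm (ψ u) := (ψ.symm_apply_apply u).symm
  rw [hup]
  exact key

/-! ## §4 `β' = β` on all of `H(F_v)` when the undoublings agree -/

/-- **LOCAL UNIQUENESS of Kudla's splitting of the doubled group at a non-split place, read on the undoubling.**  Two data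
`D, D'` with the same Leray section whose undoubled splittings `U(J)(F_v) →* S̃p(𝕎_v)` coincide have THE SAME splitting
function, `β' = β`, on all of `H(F_v) = U(J ⊕ −J)(F_v)` — provided the determinants of `U(J)(F_v) ⊕ 1` exhaust those of
`H(F_v)` (`hdet`; automatic for `n = 3`, sequel): `κ = β / β'` is a character (§1), trivial on `U(J) × 1` (§2), trivial on
`SU` (§3), hence trivial. [cite: GelbartRogawski1991, §3.1 Remark p. 457 L9–13] [cite: Kudla1994, Thm 3.1] -/
theorem beta_eq_of_undoubleLoc_eq (hT₀ : T₀.IsSymm) (hT₀d : IsUnit T₀.det) (hJ : J = T₀.map (algebraMap F E))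
    (hJD : JD = (gramD F n T₀).map (algebraMap F E)) (hn : 0 < n) (hE : IsField (LocalRing E v))
    (D D' : LocalSplittingDatum F E c (n + n) hcδ hδ hd (gramD F n T₀) (gramD_isSymm F n hT₀)
      (isUnit_det_gramD F n hT₀d) hJD v μ (deltaLagrangian F v n) (deltaLagrangian_orthogonal F v n T₀ hT₀d))
    (hr : D'.r = D.r)
    (heq : undoubleLoc F E c v n hJ hJD hcδ hδ hd hT₀ hT₀d D.localSplitting D.proj_localSplitting =
      undoubleLoc F E c v n hJ hJD hcδ hδ hd hT₀ hT₀d D'.localSplitting D'.proj_localSplitting)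
    (hdet : ∀ h : UnitaryGroup.localPi E c (n + n) JD v, ∃ u : UnitaryGroup.localPi E c n J v,
      Matrix.GeneralLinearGroup.det
          ((UnitaryGroup.localPiEquiv E c (n + n) JD v (inlLoc F E c v n hJ hJD u) : UnitaryGroup.«local» E c (n + n) JD v) :
            GL (Fin (n + n)) (LocalRing E v)) =
        Matrix.GeneralLinearGroup.det
          ((UnitaryGroup.localPiEquiv E c (n + n) JD v h : UnitaryGroup.«local» E c (n + n) JD v) :
            GL (Fin (n + n)) (LocalRing E v)))
    (h : UnitaryGroup.localPi E c (n + n) JD v) : D'.beta h = D.beta h := by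
  obtain ⟨κ, hκβ, hκ⟩ := LocalSplittingDatum.exists_betaRatioChar D D' hr
  obtain ⟨u, hu⟩ := hdet h
  have h1 : κ (inlLoc F E c v n hJ hJD u) = 1 := betaRatio_inlLoc_eq_one F E c hcδ hδ hd v μ n hT₀ hT₀d hJ hJD D D' κ hκ heq u
  have h2 : κ (h * (inlLoc F E c v n hJ hJD u)⁻¹) = 1 := by
    refine doubled_localPi_apply_eq_one_of_det_eq_one F E c hcδ hδ hd v n hT₀ hT₀d hJD hn hE κ _ ?_
    rw [map_mul, map_inv, Subgroup.coe_mul, Subgroup.coe_inv, map_mul, map_inv, ← hu, mul_inv_cancel]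
  have h3 : κ h = 1 := by
    have e : h = h * (inlLoc F E c v n hJ hJD u)⁻¹ * inlLoc F E c v n hJ hJD u := by rw [inv_mul_cancel_right]
    rw [e, map_mul, h2, h1, one_mul]
  exact inv_mul_eq_one.1 ((hκβ h).symm.trans h3)

/-! ### Build-lane note (ops-buildfix G11b-3 recipe, LEDGER B13-1, 2026-08-21)
As in the `LocalDoubledUnitary*` siblings: the public theorems of §2–§4 carry very large dependent binder telescopes and are
tagged `[implicit_reducible]` ONLY to keep them out of `lean -o`'s library-suggestion index (inert for the kernel; no statement
or proof is changed). -/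
set_option allowUnsafeReducibility true in
attribute [implicit_reducible]
  betaRatio_inlLoc_eq_one doubled_apply_eq_one_of_det_eq_one doubled_localPi_apply_eq_one_of_det_eq_one
  beta_eq_of_undoubleLoc_eq

end Doubled

end Literature.NumberTheory.GelbartRogawski1991.UnitaryDualPair.LocalSplitting

end
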